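import Summits.Langlands.Langlands.Theses.NonParallelVoid
import Literature.NumberTheory.Automorphic.ReciprocityGLnProofs
import Literature.NumberTheory.GaloisRepresentations.FramedRepTwist

/-!
# Birth skeleton (BC3) — crux `TwistedInductionParallel` of route `NonParallelVoid`

Crux item `stmt-Langlands-17000`, decl `Summit.Langlands.Langlands.Theses.NonParallelVoid.TwistedInductionParallel`
(F imaginary quadratic, `p ≥ 11` split, `ρ : Γ_F → GL₂(ℚ̄_p)` irreducible, a.e. unramified,
crystalline at both `v ∣ p` with two distinct labelled Hodge–Tate weights per label,
`ρ̄|Γ_(F(ζ_p))` absolutely irreducible, gap difference EVEN ⟹ all gaps equal).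

## The line (the route's "new lever", unchanged) and where it is cut

Proof by contraposition.  If the gaps were NOT all equal, twist `ρ` by the `p`-adic avatar `χ`
of an algebraic Hecke character of `F` whose infinity type makes `det(ρ ⊗ χ)` invariant under
`Gal(F/ℚ)` (possible exactly because the gap difference is even); then the two Hodge–Tate pairs
of `ρ ⊗ χ` above `p` are concentric, so `I = Ind_(Γ_F)^(Γ_ℚ)(ρ ⊗ χ)` is Hodge–Tate regular iff
the gaps differ, essentially self-dual (`I ≅ I^∨ ⊗ μ`, odd symplectic), crystalline and
potentially diagonalisable at `p` (`p` split: two 2-dimensional crystalline pieces over `ℚ_p`)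
and residually irreducible over `ℚ(ζ_p)` (finite part of `χ` generic); Barnet-Lamb–Gee–
Geraghty–Taylor Thm. C makes `I|Γ_L` automorphic for a totally real Galois `L/ℚ`, and since
`I ≅ I ⊗ η_(F/ℚ)` the form is automorphically induced from a cuspidal regular algebraic `π'` on
`GL₂/FL` (Arthur–Clozel), so `(ρ ⊗ χ)|Γ_(FL) ≅ r_ι(π')` with Hodge–Tate weights read off the
infinity type of `π'` (A'Campo–Hevesi–Thorne–Whitmore 2026 Thm. 1.2.1) — this is
`stub_automorphicTwist_of_nonParallel` (conclusion: `AutomorphicTwistDatum`).  Clozel's purity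
lemma for `π'` (a-multiset at `c∘σ` = `w −` a-multiset at `σ`), the CM involution of `FL`
restricting to complex conjugation of `F` (which swaps the two labels of `F` above `p`),
invariance of labelled weights under restriction `FL/F` and their shift under the algebraic
twist `χ` give equal gaps — `stub_parallel_of_automorphicTwist` — contradicting the assumption.
`TwistedInductionParallel_of` is this contraposition, kernel-checked.

Stubs honour the item's recorded risk (why-it-might-fail: potential diagonalisability of
2-dimensional crystalline representations of `Γ_(ℚ_p)`, residual irreducibility of `Ind` over
`ℚ(ζ_p)`): both live inside `stub_automorphicTwist_of_nonParallel`.  No `Disproof.lean` exists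
for this crux yet (ledger crux ls: no workfiles, 2026-08-17).

Sources: BarnetlambEtAl2014 (Thm. C = arXiv:1010.2561 Thm. C), ArthurClozelAMS120 (Ch. 3
Thm. 4.2, Lemma 6.3), HarrisLanTaylorThorneRMS2016 (Thm. A), arXiv:2607.11763 (Thm. 1.2.1),
Clozel1990 (Lemme 4.9 — tree fact `Clozel1990_regularAlgebraic`, clause (iii)),
HarrisSoudryTaylor1993, Patrikis2019 (§2.7.1, labelled weights under restriction), Calegari2010.

Shape (for `ledger skeleton check` / `#h21_check_skeleton`): each stub is
`theorem stub_<name> : <statement> := by sorry`; `_Goal.stub_<name> : Prop := type_of% @stub_<name>`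
names that statement; `TwistedInductionParallel_of (h₁ : _Goal.stub_automorphicTwist_of_nonParallel)
(h₂ : _Goal.stub_parallel_of_automorphicTwist) : …TwistedInductionParallel` is pure logic (no `sorry`)
and concludes the route decl BY NAME; the last `example` feeds the two stubs to it.

BC3 probes (planner folder `bc/probe_*.lean`, statements inlined, no sorried stub in scope): for each
stub, `stub → TwistedInductionParallel` and `stub → Langlands` by `first | exact? | simpa | aesop` FAIL
(rc 1 at `maxHeartbeats 400000`; split diagnostics: `exact?` "could not close the goal", `simpa`
"assumption failed"/timeout, `aesop` "failed after exhaustive search"/timeout) — recorded in the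
planner's NOTES.md and in `Lines/birth.md`.
-/

noncomputable section

open scoped NumberField
open NumberField IsDedekindDomain Field Filter
open Literature.NumberTheory.GaloisRepresentations Literature.NumberTheory.PAdicHodge
open Literature.NumberTheory.Automorphic

-- `Summit.Langlands.Langlands.…` repeats a namespace component by design (D-0017 nested layout).
set_option linter.dupNamespace false

namespace Summit.Langlands.Langlands.Cruxes.TwistedInductionParallel.Birth

/-! ## 0. The waypoint -/

/-- **WAYPOINT of the line: the automorphic shadow of the twist.**  For `ρ : Γ_F → GL₂(ℚ̄_p)`
(`F` a number field): there are
* a continuous character `χ : Γ_F → ℚ̄_pˣ` which is Hodge–Tate-algebraic above `p` — at every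
  place `v ∣ p` and every label `τ : F_v → ℚ̄_p` the rank-one representation `χ · 1` has ONE
  labelled Hodge–Tate weight `{k}` (intended: the `p`-adic avatar of an algebraic Hecke character
  `φ` of `F` of infinity type `(k_v)`; Weil, Serre *Abelian ℓ-adic representations* III.A);
* a CM number field `F' ⊇ F` (intended: `F' = F·L`, `L/ℚ` totally real Galois, produced by
  Barnet-Lamb–Gee–Geraghty–Taylor Thm. C applied to `Ind_{Γ_F}^{Γ_ℚ}(ρ ⊗ χ)`),
* a cuspidal automorphic representation `π'` of `GL₂(𝔸_{F'})` with a regular algebraic infinity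
  type `T` and `ι : ℚ̄_p ≃ ℂ` such that `(ρ ⊗ χ)|_{Γ_{F'}}` has Harris–Lan–Taylor–Thorne's
  characterising property of `r_ι(π')` (`HarrisLanTaylorThorne2016.IsCompatible`), AND whose
  labelled Hodge–Tate weights at every `v' ∣ p`, `τ' : F'_{v'} → ℚ̄_p` are read off the
  archimedean parameter of `π'` at the complex embedding `ι ∘ τ' ∘ (F' → F'_{v'})`:
  `HT_{τ'}((ρ⊗χ)|F') = u · {a-multiset of T at ι∘τ'} + s` for ONE affine renormalisation
  `(u, s) ∈ ℂ²` common to all labels (it absorbs the `C`/`L`-algebraic half-twist `|det|^{±1/2}`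
  and the sign convention `HT(ε) = ∓1`; intended `u = -1` or `1`, `s = ±1/2`;
  A'Campo–Hevesi–Thorne–Whitmore arXiv:2607.11763 Thm. 1.2.1: `HT_τ(r_{π,ι}) = {λ_{ιτ,1} + 1, λ_{ιτ,2}}`).
No automorphic representation is constructible in the tree, so the datum is not cheaply inhabited;
it is the interface between the potential-automorphy stub and the purity stub below.
[cite: BarnetlambEtAl2014, Thm. C] [cite: HarrisLanTaylorThorneRMS2016, Thm. A] [cite: AHTW2026, Thm. 1.2.1] -/
def AutomorphicTwistDatum (F : Type) [Field F] [NumberField F] (p : ℕ) [Fact p.Prime]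
    (ρ : FramedGaloisRep F (PadicAlgCl p) 2) : Prop :=
  ∃ χ : absoluteGaloisGroup F →ₜ* (PadicAlgCl p)ˣ,
    (∀ (v : HeightOneSpectrum (𝓞 F)) (hv : ((p : ℕ) : 𝓞 F) ∈ v.asIdeal),
      letI := (fontainePstAdicCompletion v p hv).algebra
      ∀ τ : v.adicCompletion F →ₐ[ℚ_[p]] PadicAlgCl p, ∃ k : ℤ,
        FramedGaloisRep.labelledHodgeTateWeightsAt
            ((FramedRep.scalar (PadicAlgCl p) 1).comp χ) v
            (fontainePstAdicCompletion v p hv).algebra (fontainePstAdicCompletion v p hv).𝔅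
            τ.toRingHom = {k}) ∧
    ∃ (F' : Type) (_ : Field F') (_ : NumberField F') (_ : Algebra F F'),
      IsCMField F' ∧
      ∃ (hcpt : isCompact_glFiniteIntegralLevel 2 F') (π' : CuspidalAutomorphicRepData 2 F' hcpt)
        (T : InfinityType F' 2) (ι : PadicAlgCl p ≃+* ℂ) (u s : ℂ),
        π'.1.HasInfinityType T ∧ T.IsRegularAlgebraic ∧
        HarrisLanTaylorThorne2016.IsCompatible π'.1 ι
          (FramedGaloisRep.restrictField F' (FramedRep.twist ρ χ)) ∧
        ∀ (v' : HeightOneSpectrum (𝓞 F')) (hv' : ((p : ℕ) : 𝓞 F') ∈ v'.asIdeal),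
          letI := (fontainePstAdicCompletion v' p hv').algebra
          ∀ τ' : v'.adicCompletion F' →ₐ[ℚ_[p]] PadicAlgCl p,
            ((FramedGaloisRep.restrictField F' (FramedRep.twist ρ χ)).labelledHodgeTateWeightsAt v'
                (fontainePstAdicCompletion v' p hv').algebra (fontainePstAdicCompletion v' p hv').𝔅
                τ'.toRingHom).map (fun h : ℤ => (h : ℂ)) =
              ((T (ι.toRingHom.comp (τ'.toRingHom.comp
                  (algebraMap F' (v'.adicCompletion F'))))).map ArchWeight.a).map
                (fun a : ℂ => u * a + s)

/-! ## 1. The two stubs -/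

/-- **Stub 1 (load-bearing, size L): potential automorphy of the twisted representation over a CM
extension, in the non-parallel case.**  Under the crux hypotheses and the NEGATION of its conclusion
(some two labels have different gaps), the twisted-induction argument of the module docstring
(Hecke character with `2(l − k) =` gap difference; `Ind(ρ⊗χ)` regular, odd essentially self-dual,
potentially diagonalisable, residually irreducible over `ℚ(ζ_p)`; BLGGT Thm. C over a totally real
`L`; Arthur–Clozel descent of the `η_(F/ℚ)`-stable form to a cuspidal regular algebraic `π'` on
`GL₂/FL`; AHTW Thm. 1.2.1 for the Hodge–Tate weights of `r_ι(π')`) produces an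
`AutomorphicTwistDatum F p ρ`.  Why plausibly true: every ingredient is a printed theorem except
potential diagonalisability of 2-dimensional crystalline representations of `Γ_(ℚ_p)` with distinct
weights (believed known: Kisin components + ordinary/induced points; the item's recorded risk).
[cite: BarnetlambEtAl2014, Thm. C] [cite: ArthurClozelAMS120, Ch. 3 Thm. 4.2 and Lemma 6.3]
[cite: AHTW2026, Thm. 1.2.1] [cite: HarrisSoudryTaylor1993] -/
theorem stub_automorphicTwist_of_nonParallel :
    ∀ (F : Type) [Field F] [NumberField F] [Algebra.IsQuadraticExtension ℚ F],
    NumberField.IsTotallyComplex F → ∀ (p : ℕ) [Fact p.Prime] (ρ :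
    Literature.NumberTheory.GaloisRepresentations.FramedGaloisRep F (PadicAlgCl p) 2),
    ρ.toGaloisRep.IsIrreducible → (∀ᶠ v : IsDedekindDomain.HeightOneSpectrum
    (NumberField.RingOfIntegers F) in Filter.cofinite, ρ.IsUnramifiedAt v) → (∀ (v :
    IsDedekindDomain.HeightOneSpectrum (NumberField.RingOfIntegers F)) (hv : ((p : ℕ) :
    NumberField.RingOfIntegers F) ∈ v.asIdeal),
    (Literature.NumberTheory.PAdicHodge.fontainePstAdicCompletion v p hv).IsDeRhamFramed (ρ.toLocal
    v) ∧ (letI := (Literature.NumberTheory.PAdicHodge.fontainePstAdicCompletion v p hv).algebra; ∀ τ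
    : v.adicCompletion F →ₐ[ℚ_[p]] PadicAlgCl p, ∃ a b : ℤ, a < b ∧ ρ.labelledHodgeTateWeightsAt v
    (Literature.NumberTheory.PAdicHodge.fontainePstAdicCompletion v p hv).algebra
    (Literature.NumberTheory.PAdicHodge.fontainePstAdicCompletion v p hv).𝔅 τ.toRingHom = {a, b})) →
    (11 ≤ p ∧ (∃ v w : IsDedekindDomain.HeightOneSpectrum (NumberField.RingOfIntegers F), v ≠ w ∧
    ((p : ℕ) : NumberField.RingOfIntegers F) ∈ v.asIdeal ∧ ((p : ℕ) : NumberField.RingOfIntegers F)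
    ∈ w.asIdeal) ∧ (∀ (v : IsDedekindDomain.HeightOneSpectrum (NumberField.RingOfIntegers F)) (hv :
    ((p : ℕ) : NumberField.RingOfIntegers F) ∈ v.asIdeal),
    (Literature.NumberTheory.PAdicHodge.fontainePstAdicCompletion v p hv).IsCrystallineFramed
    (ρ.toLocal v)) ∧
    Literature.NumberTheory.GaloisRepresentations.FramedGaloisRep.IsResiduallyAbsIrreducible
    (ρ.restrictField (CyclotomicField p F))) → (∀ (v : IsDedekindDomain.HeightOneSpectrum
    (NumberField.RingOfIntegers F)) (hv : ((p : ℕ) : NumberField.RingOfIntegers F) ∈ v.asIdeal) (w :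
    IsDedekindDomain.HeightOneSpectrum (NumberField.RingOfIntegers F)) (hw : ((p : ℕ) :
    NumberField.RingOfIntegers F) ∈ w.asIdeal), letI :=
    (Literature.NumberTheory.PAdicHodge.fontainePstAdicCompletion v p hv).algebra; letI :=
    (Literature.NumberTheory.PAdicHodge.fontainePstAdicCompletion w p hw).algebra; ∀ (τ :
    v.adicCompletion F →ₐ[ℚ_[p]] PadicAlgCl p) (σ : w.adicCompletion F →ₐ[ℚ_[p]] PadicAlgCl p) (a b
    a' b' : ℤ), ρ.labelledHodgeTateWeightsAt v
    (Literature.NumberTheory.PAdicHodge.fontainePstAdicCompletion v p hv).algebra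
    (Literature.NumberTheory.PAdicHodge.fontainePstAdicCompletion v p hv).𝔅 τ.toRingHom = {a, b} → a
    < b → ρ.labelledHodgeTateWeightsAt w
    (Literature.NumberTheory.PAdicHodge.fontainePstAdicCompletion w p hw).algebra
    (Literature.NumberTheory.PAdicHodge.fontainePstAdicCompletion w p hw).𝔅 σ.toRingHom = {a', b'} →
    a' < b' → Even (b - a + (b' - a'))) → ¬ (∃ g : ℤ, ∀ (v : IsDedekindDomain.HeightOneSpectrum
    (NumberField.RingOfIntegers F)) (hv : ((p : ℕ) : NumberField.RingOfIntegers F) ∈ v.asIdeal),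
    letI := (Literature.NumberTheory.PAdicHodge.fontainePstAdicCompletion v p hv).algebra; ∀ τ :
    v.adicCompletion F →ₐ[ℚ_[p]] PadicAlgCl p, ∃ a : ℤ, ρ.labelledHodgeTateWeightsAt v
    (Literature.NumberTheory.PAdicHodge.fontainePstAdicCompletion v p hv).algebra
    (Literature.NumberTheory.PAdicHodge.fontainePstAdicCompletion v p hv).𝔅 τ.toRingHom = {a, a +
    g}) → AutomorphicTwistDatum F p ρ := by
  sorry

/-- **Stub 2 (size M): purity descent — an automorphic twist datum forces parallel gaps.**  For `F`
imaginary quadratic, `ρ : Γ_F → GL₂(ℚ̄_p)` de Rham above `p` with two distinct labelled weights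
`{a, b}` at every label, an `AutomorphicTwistDatum F p ρ` implies that all gaps `b − a` are equal:
Clozel's purity lemma for the regular algebraic cuspidal `π'` (tree fact
`Clozel1990_regularAlgebraic`, clause (iii): a-multiset at `conj ∘ σ` is `w −` a-multiset at `σ`),
`conj ∘ σ = σ ∘ c` for every complex embedding `σ` of the CM field `F'`, the CM involution `c`
of `F'` inducing complex conjugation on `F` (which exchanges the two labels of `F` above `p`),
invariance of labelled Hodge–Tate weights under restriction to `Γ_(F')` (Patrikis §2.7.1) and the
shift `HT_τ(ρ ⊗ χ) = HT_τ(ρ) + k_τ` for the Hodge–Tate-algebraic `χ`; an affine map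
`h ↦ C − h` preserves gaps.  Why it might fail as typed: only through the pinned Fontaine datum
(restriction/twist bookkeeping of `labelledHodgeTateWeightsAt` is not yet in the tree).
[cite: Clozel1990, Lemme 4.9] [cite: Patrikis2019, §2.7.1] -/
theorem stub_parallel_of_automorphicTwist :
    ∀ (F : Type) [Field F] [NumberField F] [Algebra.IsQuadraticExtension ℚ F],
    NumberField.IsTotallyComplex F → ∀ (p : ℕ) [Fact p.Prime] (ρ :
    Literature.NumberTheory.GaloisRepresentations.FramedGaloisRep F (PadicAlgCl p) 2), (∀ (v :
    IsDedekindDomain.HeightOneSpectrum (NumberField.RingOfIntegers F)) (hv : ((p : ℕ) :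
    NumberField.RingOfIntegers F) ∈ v.asIdeal),
    (Literature.NumberTheory.PAdicHodge.fontainePstAdicCompletion v p hv).IsDeRhamFramed (ρ.toLocal
    v) ∧ (letI := (Literature.NumberTheory.PAdicHodge.fontainePstAdicCompletion v p hv).algebra; ∀ τ
    : v.adicCompletion F →ₐ[ℚ_[p]] PadicAlgCl p, ∃ a b : ℤ, a < b ∧ ρ.labelledHodgeTateWeightsAt v
    (Literature.NumberTheory.PAdicHodge.fontainePstAdicCompletion v p hv).algebra
    (Literature.NumberTheory.PAdicHodge.fontainePstAdicCompletion v p hv).𝔅 τ.toRingHom = {a, b})) →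
    AutomorphicTwistDatum F p ρ → ∃ g : ℤ, ∀ (v : IsDedekindDomain.HeightOneSpectrum
    (NumberField.RingOfIntegers F)) (hv : ((p : ℕ) : NumberField.RingOfIntegers F) ∈ v.asIdeal),
    letI := (Literature.NumberTheory.PAdicHodge.fontainePstAdicCompletion v p hv).algebra; ∀ τ :
    v.adicCompletion F →ₐ[ℚ_[p]] PadicAlgCl p, ∃ a : ℤ, ρ.labelledHodgeTateWeightsAt v
    (Literature.NumberTheory.PAdicHodge.fontainePstAdicCompletion v p hv).algebra
    (Literature.NumberTheory.PAdicHodge.fontainePstAdicCompletion v p hv).𝔅 τ.toRingHom = {a, a + g} := by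
  sorry

/-! ## 2. The stub statements as named `Prop`s (literally the types of the stubs; no `sorry` inherited) -/

namespace _Goal

/-- The statement of `stub_automorphicTwist_of_nonParallel`, as a named `Prop` (literally its type). [folklore] -/
def stub_automorphicTwist_of_nonParallel : Prop :=
  type_of% @Summit.Langlands.Langlands.Cruxes.TwistedInductionParallel.Birth.stub_automorphicTwist_of_nonParallel

/-- The statement of `stub_parallel_of_automorphicTwist`, as a named `Prop` (literally its type). [folklore] -/
def stub_parallel_of_automorphicTwist : Prop :=
  type_of% @Summit.Langlands.Langlands.Cruxes.TwistedInductionParallel.Birth.stub_parallel_of_automorphicTwist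

end _Goal

/-! ## 3. The composition (kernel-checked, no `sorry`): ¬parallel → automorphic twist datum → parallel -/

/-- **Composition (kernel-checked, no sorry): the two stubs give the crux BY NAME.**
Contraposition: if the conclusion of `TwistedInductionParallel` failed, Stub 1 would produce an
automorphic twist datum and Stub 2 would force the conclusion.  Hypotheses are, by name, the statements
of the two stubs (`_Goal.stub_…`, literally their types); the conclusion is the route decl. [folklore] -/
theorem TwistedInductionParallel_of (h₁ : _Goal.stub_automorphicTwist_of_nonParallel)
    (h₂ : _Goal.stub_parallel_of_automorphicTwist) :
    Summit.Langlands.Langlands.Theses.NonParallelVoid.TwistedInductionParallel := by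
  intro F _ _ _ hF p _ ρ hirr hunr hHT hG hE
  by_contra hC
  exact hC (h₂ F hF p ρ hHT (h₁ F hF p ρ hirr hunr hHT hG hE hC))

/-- By-name sanity check (an `example`, not a declaration of the file): the two stubs feed the
composition as they stand. -/
example : Summit.Langlands.Langlands.Theses.NonParallelVoid.TwistedInductionParallel :=
  TwistedInductionParallel_of stub_automorphicTwist_of_nonParallel stub_parallel_of_automorphicTwist

end Summit.Langlands.Langlands.Cruxes.TwistedInductionParallel.Birth
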